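import Summits.QuantumFields.YangMills.Theorems.BalabanLadderUVSeamRecBoxClassicalSplit
import Summits.QuantumFields.YangMills.Theorems.BalabanLadderUVSeamRecColdWallDirichletPinning
import Summits.QuantumFields.YangMills.Theorems.WeakCouplingRatesEventuallyPow
import HarnessLib

/-!
# Crux `UVSeamRec` (stmt-QuantumFields-20043), line «coldwall_pure», stub `stub_coldWallSplit` (CW): THE TWO ELEMENTARY CORNERS —
# quantum centre response ≤ classical Dirichlet ENERGY + thermal slop (every cube, every exterior, every `β ≥ 1`), and the large-carrier corner

Helper file (`--supports stmt-QuantumFields-20043`) of the LEAD seat `ym-spine-20043-p1` (gen 15); companion of `…ColdWallSplitCrudeGood` (the same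
seat: the crude-good corner at the TOP scale of the polynomial window from the route `WeakCouplingRates`' one-scale expansion, sub-thermal precision).
The registered stub (CW) asks, for EVERY exterior `η` on the femto window,
`(R⁴/C₁)|kerE^η(plane q x) − kerE^𝟙(plane q x)| ≤ A₂ + carrierCl rF C_s 1 β R q x η`, `carrierCl = βR⁴·classicalResponse/C_s`, the classical
RESPONSE `m₀(η) − m₁(η)` of the centre plaquette (`…ClassicalResponseDefs`).  This file records what the tree's ELEMENTARY one-box Laplace bounds
(gen 11: `ThermalFloor.kerE_wilsonBoundaryAction_le_of_competitor`, `kerE_wilsonBoundaryAction_mem_Icc`, `kerE_deficit_le_kerE_wilsonBoundaryAction`)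
give toward it, with NO expansion and NO window:
* §1 geometry/bookkeeping: `fst_range_of_touching_cube` (plaquettes touching the cube `(x − R − 1, 2R + 3)` are based in the corona range
  `[x − R − 2, x + R + 2]⁴`), `glueWith_restrict_self`, `wilsonBoundaryAction_le_of_coronaGood`.
* §2 **`kerE_deficit_le_tiltedMin_add`** / `…_le_action_add`: for every cube, `β ≥ 1`, plane, EVERY exterior `η` (and every interior competitor `ζ₀`):
  `0 ≤ kerE^η(2 − plane q x) ≤ m₀(η) + 120(2R+3)⁴(38 + 12 log β)/β ≤ S_Λ(ζ₀ ∨ η) + 120(2R+3)⁴(38 + 12 log β)/β` (the centre deficit is one of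
  the non-negative terms of `S_Λ`; the box mean of `S_Λ` is the classical Dirichlet minimum `m₀(η) = tiltedMin … 0 η` up to the thermal excess);
  **`abs_kerE_plane_sub_le_tiltedMin_add`**: `|kerE^η(plane q x) − kerE^𝟙(plane q x)| ≤ m₀(η) + 120(2R+3)⁴(38 + 12 log β)/β`.
* §3 **`coldWallSplit_energyCarrier`** — THE ENERGY CORNER: for every `β ≥ 1`, `R`, `q`, `x`, `η`, `C₁ > 0`:
  `(R⁴/C₁)|kerE^η(plane) − kerE^𝟙(plane)| ≤ (R⁴/C₁)·m₀(η) + 120R⁴(2R+3)⁴(38 + 12 log β)/(C₁β)` — (CW) with the classical ENERGY of the box in place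
  of `β ×` the classical RESPONSE of the centre plaquette (no `β`, no window; `m₀ ≥ classicalResponse`); **`coldWallSplit_of_large_carrier`** — THE
  LARGE-CARRIER CORNER: (CW) holds trivially whenever `A₂ + carrierCl ≥ 4R⁴/C₁` (both deficits lie in `[0, 4]`).  Between the two corners lies the
  located open content of (CW): exteriors with box energy `m₀(η) ≳ C₁A₂/R⁴` but centre response `≲ C_s/(C₁β)` (boundary-energetic, centre-calm).
* §4 **`coldWallSplit_coronaGood_window`**: for `0 < θ ≤ 1/16`, eventually in `β`, for ALL `R + 1 ≤ ⌈β^θ⌉` (the whole window, exponent up to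
  `1/16 > 1/100`), all planes, sites and all exteriors whose plaquettes based in the corona range have deficit `≤ β^{2θ/5−1}`:
  `R⁴·|kerE^η(plane q x) − kerE^𝟙(plane q x)| ≤ β^{−1/4}` (competitor `ζ₀ = η|_Λ`: `S_Λ(η) ≤ 120(2R+3)⁴β^{2θ/5−1}`; `log β ≤ 8β^{1/8}`), and the literal
  (CW) inequality there with any constants, `coldWallSplit_inequality_coronaGood_window`.  Compared with `…ColdWallSplitCrudeGood`: every scale of a
  wider window by elementary means, but only super-thermal precision `O(R⁴ log β/β)` on the kernel means themselves (the expansion gives `o(1/β)`).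
HONEST FRAMING: corners of (CW) by positivity and one-box Laplace bounds; the carrier-paying middle of (CW), (DR)'s femto tail, (GD) and the floors are
untouched; nothing of E0′, NT or the gap; YM mass gap NOT proved; not Clay.
-/

set_option autoImplicit false

noncomputable section

open MeasureTheory Finset Filter
open Literature.MathematicalPhysics.QuantumLattice (LGConfig ZdEdge ZdPlaquette plaquettesTouching plaquetteEdges mem_plaquettesTouching_iff
  plaquetteObs fundamentalRep fundamentalLatticeRep wilsonBoundaryAction)
open Literature.Probability.LatticeModels (glueWith glueWith_apply_mem glueWith_apply_not_mem)
open Summit.QuantumFields.YangMills.Cruxes.OSLegsFromFemtoAndGap.DlrCollarTransfer (cubeSites cubeEdges kerE plane continuous_plane)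
open Summit.QuantumFields.YangMills.Cruxes.UVSeamRec.ClassicalResponse.ThermalFloor (kerE_wilsonBoundaryAction_le_of_competitor
  kerE_wilsonBoundaryAction_mem_Icc kerE_deficit_le_kerE_wilsonBoundaryAction card_plaquettesTouching_cubeEdges_le kerE_one_deficit_le_pointwise)
open Summit.QuantumFields.YangMills.Theorems.WeakCouplingRates (exists_const_mul_boxSide_pow_mul_rpow_le exists_const_mul_rpow_le_rpow)

namespace Summit.QuantumFields.YangMills.Cruxes.UVSeamRec.ClassicalResponse.ColdWall

/-! ### §1 Geometry and bookkeeping -/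

/-- A plaquette touching the cube `(x − R − 1, 2R + 3)` is based in the corona range `[x − R − 2, x + R + 2]⁴`. [folklore] -/
theorem fst_range_of_touching_cube {x : Fin 4 → ℤ} {R : ℕ} {p : ZdPlaquette 4}
    (hp : p ∈ plaquettesTouching (cubeEdges (fun k => x k - ((R : ℤ) + 1)) (2 * R + 3))) (k : Fin 4) :
    x k - R - 2 ≤ p.1 k ∧ p.1 k ≤ x k + R + 2 := by
  rw [mem_plaquettesTouching_iff] at hp
  obtain ⟨e, he⟩ := hp
  rw [mem_inter] at he
  obtain ⟨he1, he2⟩ := he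
  obtain ⟨y, l⟩ := e
  have hy : x k - ((R : ℤ) + 1) ≤ y k ∧ y k < x k - ((R : ℤ) + 1) + (2 * R + 3 : ℕ) := by
    unfold cubeEdges cubeSites at he2
    simp only [Finset.mem_filter, Finset.mem_product, Finset.mem_univ, and_true, Fintype.mem_piFinset, Finset.mem_Ico] at he2
    exact he2.1 k
  simp only [plaquetteEdges, mem_insert, mem_singleton, Prod.mk.injEq] at he1
  have hs : ∀ (i : Fin 4), (p.1 + Pi.single i (1 : ℤ) : Fin 4 → ℤ) k = p.1 k + (if k = i then 1 else 0) := fun i => by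
    simp only [Pi.add_apply, Pi.single_apply]
  push_cast at hy
  rcases he1 with ⟨rfl, -⟩ | ⟨rfl, -⟩ | ⟨rfl, -⟩ | ⟨rfl, -⟩
  · constructor <;> omega
  · rw [hs] at hy; split_ifs at hy <;> constructor <;> omega
  · rw [hs] at hy; split_ifs at hy <;> constructor <;> omega
  · constructor <;> omega

/-- Re-gluing the restriction of an exterior into itself gives it back. [folklore] -/
theorem glueWith_restrict_self {G : Type} (Λ : Finset (ZdEdge 4)) (η : LGConfig 4 G) :
    glueWith Λ (fun e : ↥Λ => η e) η = η := by
  funext e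
  by_cases he : e ∈ Λ
  · rw [glueWith_apply_mem _ _ _ he]
  · rw [glueWith_apply_not_mem _ _ _ he]

/-- **Corona-good exteriors have small boundary action**: if every plaquette of `η` based in the corona range `[x − R − 2, x + R + 2]⁴` has deficit
`2 − plane ≤ s` (`0 ≤ s`), then `S_Λ(η) ≤ 120(2R+3)⁴·s` for the cube `Λ = (x − R − 1, 2R + 3)` (fundamental `SU(2)`). [folklore] -/
theorem wilsonBoundaryAction_le_of_coronaGood {x : Fin 4 → ℤ} {R : ℕ} {s : ℝ} (hs : 0 ≤ s) {η : LGConfig 4 (Matrix.specialUnitaryGroup (Fin 2) ℂ)}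
    (hη : ∀ y : Fin 4 → ℤ, (∀ k : Fin 4, x k - R - 2 ≤ y k ∧ y k ≤ x k + R + 2) → ∀ i j : Fin 4, i < j →
      2 - plane (Matrix.specialUnitaryGroup (Fin 2) ℂ) (fundamentalLatticeRep 2) (i, j) y η ≤ s) :
    wilsonBoundaryAction (fundamentalRep (Fin 2)) (cubeEdges (fun k => x k - ((R : ℤ) + 1)) (2 * R + 3)) η ≤
      120 * ((2 * R + 3 : ℕ) : ℝ) ^ 4 * s := by
  unfold wilsonBoundaryAction
  have hterm : ∀ p ∈ plaquettesTouching (cubeEdges (fun k => x k - ((R : ℤ) + 1)) (2 * R + 3)),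
      ((2 : ℕ) : ℝ) - plaquetteObs (fundamentalRep (Fin 2)) p.1 p.2.1.1 p.2.1.2 η ≤ s := by
    intro p hp
    have h := hη p.1 (fst_range_of_touching_cube hp) p.2.1.1 p.2.1.2 p.2.2
    rw [Summit.QuantumFields.YangMills.Cruxes.NT.BoundaryLaw.plane_eq_plaquetteObs] at h
    exact_mod_cast h
  have hcard : ((plaquettesTouching (cubeEdges (fun k => x k - ((R : ℤ) + 1)) (2 * R + 3))).card : ℝ) ≤ 120 * ((2 * R + 3 : ℕ) : ℝ) ^ 4 := by
    exact_mod_cast card_plaquettesTouching_cubeEdges_le (fun k => x k - ((R : ℤ) + 1)) (2 * R + 3)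
  calc ∑ p ∈ plaquettesTouching (cubeEdges (fun k => x k - ((R : ℤ) + 1)) (2 * R + 3)),
        (((2 : ℕ) : ℝ) - plaquetteObs (fundamentalRep (Fin 2)) p.1 p.2.1.1 p.2.1.2 η)
      ≤ ∑ _p ∈ plaquettesTouching (cubeEdges (fun k => x k - ((R : ℤ) + 1)) (2 * R + 3)), s := Finset.sum_le_sum hterm
    _ = (plaquettesTouching (cubeEdges (fun k => x k - ((R : ℤ) + 1)) (2 * R + 3))).card * s := by rw [Finset.sum_const, nsmul_eq_mul]
    _ ≤ 120 * ((2 * R + 3 : ℕ) : ℝ) ^ 4 * s := mul_le_mul_of_nonneg_right hcard hs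

/-! ### §2 The centre deficit under any exterior: classical Dirichlet energy + thermal excess -/

/-- **The centre deficit is at most the classical Dirichlet energy plus the thermal excess** (`SU(2)`, every cube `(x − R − 1, 2R+3)`, `β ≥ 1`, every
plane `q.1 < q.2`, EVERY exterior `η`): `kerE^η(2 − plane q x) ≤ m₀(η) + 120(2R+3)⁴(38 + 12 log β)/β`, `m₀(η) = tiltedMin rF (x−R−1) (2R+3) q x 0 η`. [folklore] -/
theorem kerE_deficit_le_tiltedMin_add {β : ℝ} (hβ : 1 ≤ β) (R : ℕ) (q : Fin 4 × Fin 4) (hq : q.1 < q.2) (x : Fin 4 → ℤ)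
    (η : LGConfig 4 (Matrix.specialUnitaryGroup (Fin 2) ℂ)) :
    kerE (Matrix.specialUnitaryGroup (Fin 2) ℂ) (fundamentalLatticeRep 2) β (fun k => x k - (R + 1)) (2 * R + 3) η
        (fun U => 2 - plane (Matrix.specialUnitaryGroup (Fin 2) ℂ) (fundamentalLatticeRep 2) q x U) ≤
      tiltedMin (fundamentalLatticeRep 2) (fun k => x k - (R + 1)) (2 * R + 3) q x 0 η +
        120 * ((2 * R + 3 : ℕ) : ℝ) ^ 4 * ((38 + 12 * Real.log β) / β) := by
  have h1 := kerE_deficit_le_kerE_wilsonBoundaryAction (Matrix.specialUnitaryGroup (Fin 2) ℂ) (fundamentalLatticeRep 2) β hq x R η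
  have hN : ((fundamentalLatticeRep 2).N : ℝ) = 2 := by simp
  simp only [hN] at h1
  have h2 := (kerE_wilsonBoundaryAction_mem_Icc (fun k => x k - (R + 1)) (2 * R + 3) q x η hβ).2
  have h3 : ((plaquettesTouching (cubeEdges (fun k => x k - ((R : ℤ) + 1)) (2 * R + 3))).card : ℝ) ≤ 120 * ((2 * R + 3 : ℕ) : ℝ) ^ 4 := by
    exact_mod_cast card_plaquettesTouching_cubeEdges_le (fun k => x k - ((R : ℤ) + 1)) (2 * R + 3)
  have hβ0 : 0 < β := by linarith
  have hpos : 0 ≤ (38 + 12 * Real.log β) / β := div_nonneg (by linarith [Real.log_nonneg hβ]) hβ0.le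
  exact h1.trans (h2.trans (by nlinarith [mul_le_mul_of_nonneg_right h3 hpos]))

/-- The same with any interior COMPETITOR `ζ₀` in place of the minimiser: `kerE^η(2 − plane q x) ≤ S_Λ(ζ₀ ∨ η) + 120(2R+3)⁴(38 + 12 log β)/β`. [folklore] -/
theorem kerE_deficit_le_action_add {β : ℝ} (hβ : 1 ≤ β) (R : ℕ) (q : Fin 4 × Fin 4) (hq : q.1 < q.2) (x : Fin 4 → ℤ)
    (η : LGConfig 4 (Matrix.specialUnitaryGroup (Fin 2) ℂ))
    (ζ₀ : ↥(cubeEdges (fun k => x k - ((R : ℤ) + 1)) (2 * R + 3)) → Matrix.specialUnitaryGroup (Fin 2) ℂ) :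
    kerE (Matrix.specialUnitaryGroup (Fin 2) ℂ) (fundamentalLatticeRep 2) β (fun k => x k - (R + 1)) (2 * R + 3) η
        (fun U => 2 - plane (Matrix.specialUnitaryGroup (Fin 2) ℂ) (fundamentalLatticeRep 2) q x U) ≤
      wilsonBoundaryAction (fundamentalRep (Fin 2)) (cubeEdges (fun k => x k - ((R : ℤ) + 1)) (2 * R + 3))
          (glueWith (cubeEdges (fun k => x k - ((R : ℤ) + 1)) (2 * R + 3)) ζ₀ η) +
        120 * ((2 * R + 3 : ℕ) : ℝ) ^ 4 * ((38 + 12 * Real.log β) / β) := by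
  have h := kerE_deficit_le_tiltedMin_add hβ R q hq x η
  have hmin := tiltedMin_le (r := fundamentalLatticeRep 2) (fun k => x k - ((R : ℤ) + 1)) (2 * R + 3) q x 0 η ζ₀
  rw [tiltedAction_zero] at hmin
  have hmin' : tiltedMin (fundamentalLatticeRep 2) (fun k => x k - ((R : ℤ) + 1)) (2 * R + 3) q x 0 η ≤
      wilsonBoundaryAction (fundamentalRep (Fin 2)) (cubeEdges (fun k => x k - ((R : ℤ) + 1)) (2 * R + 3))
        (glueWith (cubeEdges (fun k => x k - ((R : ℤ) + 1)) (2 * R + 3)) ζ₀ η) := hmin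
  linarith [h, hmin']

/-- **THE RESPONSE TO THE EXTERIOR IS AT MOST THE CLASSICAL DIRICHLET ENERGY PLUS THE THERMAL EXCESS.**  For `β ≥ 1`, every cube `(x − R − 1, 2R+3)`,
plane `q.1 < q.2` and EVERY exterior `η`: `|kerE^η(plane q x) − kerE^𝟙(plane q x)| ≤ m₀(η) + 120(2R+3)⁴(38 + 12 log β)/β` (both centre deficits are
non-negative, the cold-wall one is `≤ 120(2R+3)⁴(34 + 6 log β)/β`, `kerE_one_deficit_le_pointwise`). [folklore] -/
theorem abs_kerE_plane_sub_le_tiltedMin_add {β : ℝ} (hβ : 1 ≤ β) (R : ℕ) (q : Fin 4 × Fin 4) (hq : q.1 < q.2) (x : Fin 4 → ℤ)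
    (η : LGConfig 4 (Matrix.specialUnitaryGroup (Fin 2) ℂ)) :
    |kerE (Matrix.specialUnitaryGroup (Fin 2) ℂ) (fundamentalLatticeRep 2) β (fun k => x k - (R + 1)) (2 * R + 3) η
          (plane (Matrix.specialUnitaryGroup (Fin 2) ℂ) (fundamentalLatticeRep 2) q x) -
        kerE (Matrix.specialUnitaryGroup (Fin 2) ℂ) (fundamentalLatticeRep 2) β (fun k => x k - (R + 1)) (2 * R + 3) 1
          (plane (Matrix.specialUnitaryGroup (Fin 2) ℂ) (fundamentalLatticeRep 2) q x)| ≤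
      tiltedMin (fundamentalLatticeRep 2) (fun k => x k - (R + 1)) (2 * R + 3) q x 0 η +
        120 * ((2 * R + 3 : ℕ) : ℝ) ^ 4 * ((38 + 12 * Real.log β) / β) := by
  have hN : ((fundamentalLatticeRep 2).N : ℝ) = 2 := by simp
  -- the two deficits: `η` and the cold wall `1`
  have hd := kerE_deficit_le_tiltedMin_add hβ R q hq x η
  have hd0 := (kerE_deficit_mem_Icc (r := fundamentalLatticeRep 2) β (fun k => x k - ((R : ℤ) + 1)) (2 * R + 3) η q x).1
  have h1 : kerE (Matrix.specialUnitaryGroup (Fin 2) ℂ) (fundamentalLatticeRep 2) β (fun k => x k - (R + 1)) (2 * R + 3) 1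
        (fun U => 2 - plane (Matrix.specialUnitaryGroup (Fin 2) ℂ) (fundamentalLatticeRep 2) q x U) ≤
      120 * ((2 * R + 3 : ℕ) : ℝ) ^ 4 * ((34 + 6 * Real.log β) / β) := kerE_one_deficit_le_pointwise hβ R q hq x
  have h10 := (kerE_deficit_mem_Icc (r := fundamentalLatticeRep 2) β (fun k => x k - ((R : ℤ) + 1)) (2 * R + 3)
    (1 : LGConfig 4 (Matrix.specialUnitaryGroup (Fin 2) ℂ)) q x).1
  simp only [hN] at hd0 h10
  -- `kerE(2 − plane) = 2 − kerE(plane)`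
  rw [kerE_const_sub (r := fundamentalLatticeRep 2) β _ _ η (continuous_plane (fundamentalLatticeRep 2) q x) 2] at hd hd0
  rw [kerE_const_sub (r := fundamentalLatticeRep 2) β _ _ (1 : LGConfig 4 (Matrix.specialUnitaryGroup (Fin 2) ℂ))
    (continuous_plane (fundamentalLatticeRep 2) q x) 2] at h1 h10
  have hm0 : 0 ≤ tiltedMin (fundamentalLatticeRep 2) (fun k => x k - ((R : ℤ) + 1)) (2 * R + 3) q x 0 η := by
    obtain ⟨ζ₀, hζ₀⟩ := exists_tiltedMin_eq (r := fundamentalLatticeRep 2) (fun k => x k - ((R : ℤ) + 1)) (2 * R + 3) q x 0 η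
    rw [← hζ₀, tiltedAction_zero]
    exact Summit.QuantumFields.YangMills.Theorems.SubOnsetCeilings.Negative.wilsonBoundaryAction_nonneg (fundamentalLatticeRep 2) _ _
  have hβ0 : 0 < β := by linarith
  have hlog : (34 + 6 * Real.log β) / β ≤ (38 + 12 * Real.log β) / β :=
    div_le_div_of_nonneg_right (by linarith [Real.log_nonneg hβ]) hβ0.le
  have hS : 0 ≤ 120 * ((2 * R + 3 : ℕ) : ℝ) ^ 4 := by positivity
  have h1' := h1.trans (mul_le_mul_of_nonneg_left hlog hS)
  rw [abs_le]
  constructor <;> nlinarith [hd, hd0, h1', h10, hm0]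

/-- The same with any interior competitor `ζ₀`: `|kerE^η(plane q x) − kerE^𝟙(plane q x)| ≤ S_Λ(ζ₀ ∨ η) + 120(2R+3)⁴(38 + 12 log β)/β`. [folklore] -/
theorem abs_kerE_plane_sub_le_action_add {β : ℝ} (hβ : 1 ≤ β) (R : ℕ) (q : Fin 4 × Fin 4) (hq : q.1 < q.2) (x : Fin 4 → ℤ)
    (η : LGConfig 4 (Matrix.specialUnitaryGroup (Fin 2) ℂ))
    (ζ₀ : ↥(cubeEdges (fun k => x k - ((R : ℤ) + 1)) (2 * R + 3)) → Matrix.specialUnitaryGroup (Fin 2) ℂ) :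
    |kerE (Matrix.specialUnitaryGroup (Fin 2) ℂ) (fundamentalLatticeRep 2) β (fun k => x k - (R + 1)) (2 * R + 3) η
          (plane (Matrix.specialUnitaryGroup (Fin 2) ℂ) (fundamentalLatticeRep 2) q x) -
        kerE (Matrix.specialUnitaryGroup (Fin 2) ℂ) (fundamentalLatticeRep 2) β (fun k => x k - (R + 1)) (2 * R + 3) 1
          (plane (Matrix.specialUnitaryGroup (Fin 2) ℂ) (fundamentalLatticeRep 2) q x)| ≤
      wilsonBoundaryAction (fundamentalRep (Fin 2)) (cubeEdges (fun k => x k - ((R : ℤ) + 1)) (2 * R + 3))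
          (glueWith (cubeEdges (fun k => x k - ((R : ℤ) + 1)) (2 * R + 3)) ζ₀ η) +
        120 * ((2 * R + 3 : ℕ) : ℝ) ^ 4 * ((38 + 12 * Real.log β) / β) := by
  have h := abs_kerE_plane_sub_le_tiltedMin_add hβ R q hq x η
  have hmin := tiltedMin_le (r := fundamentalLatticeRep 2) (fun k => x k - ((R : ℤ) + 1)) (2 * R + 3) q x 0 η ζ₀
  rw [tiltedAction_zero] at hmin
  have hmin' : tiltedMin (fundamentalLatticeRep 2) (fun k => x k - ((R : ℤ) + 1)) (2 * R + 3) q x 0 η ≤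
      wilsonBoundaryAction (fundamentalRep (Fin 2)) (cubeEdges (fun k => x k - ((R : ℤ) + 1)) (2 * R + 3))
        (glueWith (cubeEdges (fun k => x k - ((R : ℤ) + 1)) (2 * R + 3)) ζ₀ η) := hmin
  linarith [h, hmin']

/-! ### §3 The two elementary corners of (CW) -/

/-- **THE ENERGY CORNER OF (CW).**  For every `β ≥ 1`, `R`, plane `q.1 < q.2`, site `x`, exterior `η` and `C₁ > 0`:
`(R⁴/C₁)·|kerE^η(plane q x) − kerE^𝟙(plane q x)| ≤ (R⁴/C₁)·m₀(η) + 120·R⁴(2R+3)⁴(38 + 12 log β)/(C₁β)` — the stub's inequality with the classical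
ENERGY `m₀(η)` of the box (which dominates the classical RESPONSE of the centre plaquette) as the payment and the thermal slop as the additive
constant; no `β`-lever, no window, no expansion. [folklore] -/
theorem coldWallSplit_energyCarrier {β : ℝ} (hβ : 1 ≤ β) (R : ℕ) (q : Fin 4 × Fin 4) (hq : q.1 < q.2) (x : Fin 4 → ℤ)
    (η : LGConfig 4 (Matrix.specialUnitaryGroup (Fin 2) ℂ)) {C₁ : ℝ} (hC₁ : 0 < C₁) :
    (R : ℝ) ^ 4 / C₁ * |kerE (Matrix.specialUnitaryGroup (Fin 2) ℂ) (fundamentalLatticeRep 2) β (fun k => x k - (R + 1)) (2 * R + 3) η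
          (plane (Matrix.specialUnitaryGroup (Fin 2) ℂ) (fundamentalLatticeRep 2) q x) -
        kerE (Matrix.specialUnitaryGroup (Fin 2) ℂ) (fundamentalLatticeRep 2) β (fun k => x k - (R + 1)) (2 * R + 3) 1
          (plane (Matrix.specialUnitaryGroup (Fin 2) ℂ) (fundamentalLatticeRep 2) q x)| ≤
      (R : ℝ) ^ 4 / C₁ * tiltedMin (fundamentalLatticeRep 2) (fun k => x k - (R + 1)) (2 * R + 3) q x 0 η +
        120 * (R : ℝ) ^ 4 * ((2 * R + 3 : ℕ) : ℝ) ^ 4 * (38 + 12 * Real.log β) / (C₁ * β) := by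
  have h := abs_kerE_plane_sub_le_tiltedMin_add hβ R q hq x η
  have hR : 0 ≤ (R : ℝ) ^ 4 / C₁ := by positivity
  have hβ0 : 0 < β := by linarith
  calc (R : ℝ) ^ 4 / C₁ * |kerE (Matrix.specialUnitaryGroup (Fin 2) ℂ) (fundamentalLatticeRep 2) β (fun k => x k - (R + 1)) (2 * R + 3) η
          (plane (Matrix.specialUnitaryGroup (Fin 2) ℂ) (fundamentalLatticeRep 2) q x) -
        kerE (Matrix.specialUnitaryGroup (Fin 2) ℂ) (fundamentalLatticeRep 2) β (fun k => x k - (R + 1)) (2 * R + 3) 1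
          (plane (Matrix.specialUnitaryGroup (Fin 2) ℂ) (fundamentalLatticeRep 2) q x)|
      ≤ (R : ℝ) ^ 4 / C₁ * (tiltedMin (fundamentalLatticeRep 2) (fun k => x k - (R + 1)) (2 * R + 3) q x 0 η +
        120 * ((2 * R + 3 : ℕ) : ℝ) ^ 4 * ((38 + 12 * Real.log β) / β)) := mul_le_mul_of_nonneg_left h hR
    _ = _ := by field_simp

/-- **THE LARGE-CARRIER CORNER OF (CW).**  Both centre deficits lie in `[0, 4]`, so `(R⁴/C₁)|kerE^η(plane) − kerE^𝟙(plane)| ≤ 4R⁴/C₁`; hence the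
stub's inequality holds for every exterior whose payment `A₂ + carrierCl rF C_s 1 β R q x η` is at least `4R⁴/C₁`, i.e. whose classical centre
response is `≥ 4C_s/(C₁β)` (up to `A₂`). [folklore] -/
theorem coldWallSplit_of_large_carrier (β : ℝ) (R : ℕ) (q : Fin 4 × Fin 4) (x : Fin 4 → ℤ) (η : LGConfig 4 (Matrix.specialUnitaryGroup (Fin 2) ℂ))
    {C₁ : ℝ} (hC₁ : 0 < C₁) (C_s A₂ : ℝ) (hpay : 4 * (R : ℝ) ^ 4 / C₁ ≤ A₂ + carrierCl (fundamentalLatticeRep 2) C_s 1 β R q x η) :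
    (R : ℝ) ^ 4 / C₁ * |kerE (Matrix.specialUnitaryGroup (Fin 2) ℂ) (fundamentalLatticeRep 2) β (fun k => x k - (R + 1)) (2 * R + 3) η
          (plane (Matrix.specialUnitaryGroup (Fin 2) ℂ) (fundamentalLatticeRep 2) q x) -
        kerE (Matrix.specialUnitaryGroup (Fin 2) ℂ) (fundamentalLatticeRep 2) β (fun k => x k - (R + 1)) (2 * R + 3) 1
          (plane (Matrix.specialUnitaryGroup (Fin 2) ℂ) (fundamentalLatticeRep 2) q x)| ≤
      A₂ + carrierCl (fundamentalLatticeRep 2) C_s 1 β R q x η := by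
  have hN : ((fundamentalLatticeRep 2).N : ℝ) = 2 := by simp
  have hd := kerE_deficit_mem_Icc (r := fundamentalLatticeRep 2) β (fun k => x k - ((R : ℤ) + 1)) (2 * R + 3) η q x
  have h1 := kerE_deficit_mem_Icc (r := fundamentalLatticeRep 2) β (fun k => x k - ((R : ℤ) + 1)) (2 * R + 3)
    (1 : LGConfig 4 (Matrix.specialUnitaryGroup (Fin 2) ℂ)) q x
  simp only [hN] at hd h1
  rw [kerE_const_sub (r := fundamentalLatticeRep 2) β _ _ η (continuous_plane (fundamentalLatticeRep 2) q x) 2] at hd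
  rw [kerE_const_sub (r := fundamentalLatticeRep 2) β _ _ (1 : LGConfig 4 (Matrix.specialUnitaryGroup (Fin 2) ℂ))
    (continuous_plane (fundamentalLatticeRep 2) q x) 2] at h1
  have habs : |kerE (Matrix.specialUnitaryGroup (Fin 2) ℂ) (fundamentalLatticeRep 2) β (fun k => x k - (R + 1)) (2 * R + 3) η
          (plane (Matrix.specialUnitaryGroup (Fin 2) ℂ) (fundamentalLatticeRep 2) q x) -
        kerE (Matrix.specialUnitaryGroup (Fin 2) ℂ) (fundamentalLatticeRep 2) β (fun k => x k - (R + 1)) (2 * R + 3) 1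
          (plane (Matrix.specialUnitaryGroup (Fin 2) ℂ) (fundamentalLatticeRep 2) q x)| ≤ 4 := by
    rw [abs_le]; constructor <;> nlinarith [hd.1, hd.2, h1.1, h1.2]
  have hR : 0 ≤ (R : ℝ) ^ 4 / C₁ := by positivity
  calc (R : ℝ) ^ 4 / C₁ * _ ≤ (R : ℝ) ^ 4 / C₁ * 4 := mul_le_mul_of_nonneg_left habs hR
    _ = 4 * (R : ℝ) ^ 4 / C₁ := by ring
    _ ≤ _ := hpay

/-! ### §4 The corona-good corner on the whole window `R + 1 ≤ ⌈β^θ⌉`, `θ ≤ 1/16` -/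

/-- **THE CORONA-GOOD CORNER OF (CW) ON THE WHOLE WINDOW, by elementary means.**  For `0 < θ ≤ 1/16` there is `β₂ > 0` such that for all `β ≥ β₂`,
ALL `R` with `R + 1 ≤ ⌈β^θ⌉`, every plane `q.1 < q.2`, site `x` and every exterior `η` each of whose plaquettes based in the corona range
`[x − R − 2, x + R + 2]⁴` has deficit `≤ β^{2θ/5−1}`: `R⁴·|kerE^η_{β,(x−R−1,2R+3)}(plane q x) − kerE^𝟙(plane q x)| ≤ β^{−1/4}` (competitor
`ζ₀ = η|_Λ`, `S_Λ(η) ≤ 120(2R+3)⁴β^{2θ/5−1}`, `log β ≤ 8β^{1/8}`, `R⁴(2R+3)⁴ ≤ (2⌈β^θ⌉+3)⁸`). [folklore] -/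
theorem coldWallSplit_coronaGood_window {θ : ℝ} (hθ : 0 < θ) (hθ₂ : θ ≤ 1 / 16) :
    ∃ β₂ : ℝ, 0 < β₂ ∧ ∀ β : ℝ, β₂ ≤ β → ∀ R : ℕ, R + 1 ≤ ⌈β ^ θ⌉₊ → ∀ (q : Fin 4 × Fin 4) (x : Fin 4 → ℤ), q.1 < q.2 →
      ∀ η : LGConfig 4 (Matrix.specialUnitaryGroup (Fin 2) ℂ),
        (∀ y : Fin 4 → ℤ, (∀ k : Fin 4, x k - R - 2 ≤ y k ∧ y k ≤ x k + R + 2) → ∀ i j : Fin 4, i < j →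
          2 - plane (Matrix.specialUnitaryGroup (Fin 2) ℂ) (fundamentalLatticeRep 2) (i, j) y η ≤ β ^ (2 * (θ / 5) - 1)) →
        (R : ℝ) ^ 4 * |kerE (Matrix.specialUnitaryGroup (Fin 2) ℂ) (fundamentalLatticeRep 2) β (fun k => x k - (R + 1)) (2 * R + 3) η
              (plane (Matrix.specialUnitaryGroup (Fin 2) ℂ) (fundamentalLatticeRep 2) q x) -
            kerE (Matrix.specialUnitaryGroup (Fin 2) ℂ) (fundamentalLatticeRep 2) β (fun k => x k - (R + 1)) (2 * R + 3) 1
              (plane (Matrix.specialUnitaryGroup (Fin 2) ℂ) (fundamentalLatticeRep 2) q x)| ≤ β ^ (-(1 / 4 : ℝ)) := by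
  obtain ⟨b₁, hb₁1, E1⟩ := exists_const_mul_boxSide_pow_mul_rpow_le (240 : ℝ) 8 (θ := θ) (a := 2 * (θ / 5) - 1) (b := -(1 / 4 : ℝ)) hθ
    (by push_cast; linarith)
  obtain ⟨b₂, -, E2⟩ := exists_const_mul_boxSide_pow_mul_rpow_le (240 * 134 : ℝ) 8 (θ := θ) (a := -(7 / 8 : ℝ)) (b := -(1 / 4 : ℝ)) hθ
    (by push_cast; linarith)
  refine ⟨max b₁ b₂, lt_of_lt_of_le one_pos (hb₁1.trans (le_max_left _ _)), fun β hβ R hR q x hq η hη => ?_⟩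
  have hb1 : b₁ ≤ β := (le_max_left _ _).trans hβ
  have hb2 : b₂ ≤ β := (le_max_right _ _).trans hβ
  have hβ1 : 1 ≤ β := hb₁1.trans hb1
  have hβ0 : 0 < β := by linarith
  -- `|Δ| ≤ S_Λ(η) + slop` with the competitor `η|_Λ`, and `S_Λ(η) ≤ 120(2R+3)⁴ β^{2θ/5−1}`
  have hΔ := abs_kerE_plane_sub_le_action_add hβ1 R q hq x η (fun e => η e)
  rw [glueWith_restrict_self] at hΔ
  have hS := wilsonBoundaryAction_le_of_coronaGood (Real.rpow_nonneg hβ0.le _) hη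
  -- `(38 + 12 log β)/β ≤ 134 β^{−7/8}`
  have hlog : (38 + 12 * Real.log β) / β ≤ 134 * β ^ (-(7 / 8 : ℝ)) := by
    have h1 : Real.log β ≤ β ^ (1 / 8 : ℝ) / (1 / 8) := Real.log_le_rpow_div hβ0.le (by norm_num)
    have h2 : 1 ≤ β ^ (1 / 8 : ℝ) := Real.one_le_rpow hβ1 (by norm_num)
    have h3 : β ^ (-(7 / 8 : ℝ)) = β ^ (1 / 8 : ℝ) / β := by
      rw [show -(7 / 8 : ℝ) = 1 / 8 - 1 by norm_num, Real.rpow_sub_one hβ0.ne']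
    rw [h3, ← mul_div_assoc, div_le_div_iff_of_pos_right hβ0]
    linarith
  -- geometry of the window
  set S : ℝ := 2 * (⌈β ^ θ⌉₊ : ℝ) + 3 with hSdef
  have hRS : (R : ℝ) ≤ S := by
    have h : (R : ℝ) + 1 ≤ (⌈β ^ θ⌉₊ : ℝ) := by exact_mod_cast hR
    rw [hSdef]; linarith [(Nat.cast_nonneg R : (0 : ℝ) ≤ R)]
  have hbS : ((2 * R + 3 : ℕ) : ℝ) ≤ S := by
    have h : (R : ℝ) + 1 ≤ (⌈β ^ θ⌉₊ : ℝ) := by exact_mod_cast hR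
    rw [hSdef]; push_cast; linarith
  have hS0 : 0 ≤ S := by rw [hSdef]; positivity
  have hR4 : (R : ℝ) ^ 4 * ((2 * R + 3 : ℕ) : ℝ) ^ 4 ≤ S ^ 8 := by
    rw [show S ^ 8 = S ^ 4 * S ^ 4 by ring]
    exact mul_le_mul (pow_le_pow_left₀ (Nat.cast_nonneg R) hRS 4) (pow_le_pow_left₀ (Nat.cast_nonneg _) hbS 4) (by positivity)
      (by positivity)
  have e1 := E1 β hb1
  have e2 := E2 β hb2
  generalize hDdef : |kerE (Matrix.specialUnitaryGroup (Fin 2) ℂ) (fundamentalLatticeRep 2) β (fun k => x k - (R + 1)) (2 * R + 3) η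
              (plane (Matrix.specialUnitaryGroup (Fin 2) ℂ) (fundamentalLatticeRep 2) q x) -
            kerE (Matrix.specialUnitaryGroup (Fin 2) ℂ) (fundamentalLatticeRep 2) β (fun k => x k - (R + 1)) (2 * R + 3) 1
              (plane (Matrix.specialUnitaryGroup (Fin 2) ℂ) (fundamentalLatticeRep 2) q x)| = D at hΔ ⊢
  generalize hWdef : wilsonBoundaryAction (fundamentalRep (Fin 2)) (cubeEdges (fun k => x k - ((R : ℤ) + 1)) (2 * R + 3)) η = W at hΔ hS
  generalize hPdef : ((2 * R + 3 : ℕ) : ℝ) = P at hΔ hS hbS hR4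
  have hP0 : 0 ≤ P := by rw [← hPdef]; positivity
  have ha0 : 0 ≤ β ^ (2 * (θ / 5) - 1) := Real.rpow_nonneg hβ0.le _
  have hc0 : 0 ≤ β ^ (-(7 / 8 : ℝ)) := Real.rpow_nonneg hβ0.le _
  have hR0 : 0 ≤ (R : ℝ) ^ 4 := pow_nonneg (Nat.cast_nonneg R) 4
  have hstep : D ≤ 120 * P ^ 4 * (β ^ (2 * (θ / 5) - 1) + 134 * β ^ (-(7 / 8 : ℝ))) := by
    have := mul_le_mul_of_nonneg_left hlog (show (0 : ℝ) ≤ 120 * P ^ 4 by positivity)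
    nlinarith [hΔ, hS, this]
  calc (R : ℝ) ^ 4 * D ≤ (R : ℝ) ^ 4 * (120 * P ^ 4 * (β ^ (2 * (θ / 5) - 1) + 134 * β ^ (-(7 / 8 : ℝ)))) :=
        mul_le_mul_of_nonneg_left hstep hR0
    _ = 120 * ((R : ℝ) ^ 4 * P ^ 4) * (β ^ (2 * (θ / 5) - 1) + 134 * β ^ (-(7 / 8 : ℝ))) := by ring
    _ ≤ 120 * S ^ 8 * (β ^ (2 * (θ / 5) - 1) + 134 * β ^ (-(7 / 8 : ℝ))) := by gcongr
    _ = 1 / 2 * (240 * S ^ 8 * β ^ (2 * (θ / 5) - 1)) + 1 / 2 * (240 * 134 * S ^ 8 * β ^ (-(7 / 8 : ℝ))) := by ring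
    _ ≤ β ^ (-(1 / 4 : ℝ)) := by linarith

/-- **THE LITERAL (CW) INEQUALITY FOR CORONA-GOOD EXTERIORS ON THE WHOLE WINDOW `R + 1 ≤ ⌈β^θ⌉`, `θ ≤ 1/16`, ANY CONSTANTS.**  For `0 < θ ≤ 1/16` and
`C_s, C₁, A₂ > 0` there is `β₂ > 0` with: for all `β ≥ β₂`, `R + 1 ≤ ⌈β^θ⌉`, `q.1 < q.2`, `x` and every corona-good `η` (deficits `≤ β^{2θ/5−1}` on the
corona range), `(R⁴/C₁)·|kerE^η(plane q x) − kerE^𝟙(plane q x)| ≤ A₂ + carrierCl rF C_s 1 β R q x η`. [folklore] -/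
theorem coldWallSplit_inequality_coronaGood_window {θ : ℝ} (hθ : 0 < θ) (hθ₂ : θ ≤ 1 / 16) {C_s C₁ A₂ : ℝ}
    (hCs : 0 < C_s) (hC₁ : 0 < C₁) (hA₂ : 0 < A₂) :
    ∃ β₂ : ℝ, 0 < β₂ ∧ ∀ β : ℝ, β₂ ≤ β → ∀ R : ℕ, R + 1 ≤ ⌈β ^ θ⌉₊ → ∀ (q : Fin 4 × Fin 4) (x : Fin 4 → ℤ), q.1 < q.2 →
      ∀ η : LGConfig 4 (Matrix.specialUnitaryGroup (Fin 2) ℂ),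
        (∀ y : Fin 4 → ℤ, (∀ k : Fin 4, x k - R - 2 ≤ y k ∧ y k ≤ x k + R + 2) → ∀ i j : Fin 4, i < j →
          2 - plane (Matrix.specialUnitaryGroup (Fin 2) ℂ) (fundamentalLatticeRep 2) (i, j) y η ≤ β ^ (2 * (θ / 5) - 1)) →
        (R : ℝ) ^ 4 / C₁ * |kerE (Matrix.specialUnitaryGroup (Fin 2) ℂ) (fundamentalLatticeRep 2) β (fun k => x k - (R + 1)) (2 * R + 3) η
              (plane (Matrix.specialUnitaryGroup (Fin 2) ℂ) (fundamentalLatticeRep 2) q x) -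
            kerE (Matrix.specialUnitaryGroup (Fin 2) ℂ) (fundamentalLatticeRep 2) β (fun k => x k - (R + 1)) (2 * R + 3) 1
              (plane (Matrix.specialUnitaryGroup (Fin 2) ℂ) (fundamentalLatticeRep 2) q x)| ≤
          A₂ + carrierCl (fundamentalLatticeRep 2) C_s 1 β R q x η := by
  obtain ⟨β₂, hβ₂, h⟩ := coldWallSplit_coronaGood_window hθ hθ₂
  obtain ⟨b, hb1, hb⟩ := exists_const_mul_rpow_le_rpow (1 / (A₂ * C₁)) (a := -(1 / 4 : ℝ)) (b := 0) (by norm_num)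
  refine ⟨max β₂ b, lt_of_lt_of_le hβ₂ (le_max_left _ _), fun β hβ R hR q x hq η hη => ?_⟩
  have hβ2 : β₂ ≤ β := (le_max_left _ _).trans hβ
  have hβ0 : 0 ≤ β := hβ₂.le.trans hβ2
  have hmainβ := h β hβ2 R hR q x hq η hη
  have hsmall : β ^ (-(1 / 4 : ℝ)) ≤ A₂ * C₁ := by
    have h1 := hb β ((le_max_right _ _).trans hβ)
    rw [Real.rpow_zero, one_div, inv_mul_le_iff₀ (mul_pos hA₂ hC₁), mul_one] at h1; exact h1
  have hcar : 0 ≤ carrierCl (fundamentalLatticeRep 2) C_s 1 β R q x η := carrierCl_nonneg hCs one_pos hβ0 R q x η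
  generalize hDdef : |kerE (Matrix.specialUnitaryGroup (Fin 2) ℂ) (fundamentalLatticeRep 2) β (fun k => x k - (R + 1)) (2 * R + 3) η
              (plane (Matrix.specialUnitaryGroup (Fin 2) ℂ) (fundamentalLatticeRep 2) q x) -
            kerE (Matrix.specialUnitaryGroup (Fin 2) ℂ) (fundamentalLatticeRep 2) β (fun k => x k - (R + 1)) (2 * R + 3) 1
              (plane (Matrix.specialUnitaryGroup (Fin 2) ℂ) (fundamentalLatticeRep 2) q x)| = D at hmainβ ⊢
  rw [div_mul_eq_mul_div, div_le_iff₀ hC₁]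
  nlinarith [hmainβ, hsmall, hcar, hC₁]

/-! ### §5 (appended, LEAD g15) The located residual of (CW): reduction to boundary-energetic, centre-calm exteriors -/

/-- **REDUCTION OF (CW) TO ITS RESIDUAL CLASS.**  Fix `β ≥ 1`, a cube `(x − R − 1, 2R + 3)`, a plane `q.1 < q.2`, constants `C₁, C_s > 0`, `A₂`, and
an exterior `η`.  If the stub's inequality `(R⁴/C₁)|kerE^η(plane q x) − kerE^𝟙(plane q x)| ≤ A₂ + carrierCl rF C_s 1 β R q x η` holds under the
RESIDUAL hypotheses — box energy above resolution, `(R⁴/C₁)(m₀(η) + 120(2R+3)⁴(38 + 12 log β)/β) > A₂`, AND payment below the trivial bound,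
`A₂ + carrierCl < 4R⁴/C₁` — then it holds outright: outside the residual class one of the two elementary corners (`coldWallSplit_energyCarrier`,
`coldWallSplit_of_large_carrier`) applies.  So the open content of `stub_coldWallSplit` at `(β, R, q, x)` is EXACTLY the class of exteriors with
classical Dirichlet energy `m₀(η) ≳ C₁A₂/R⁴` but classical centre response `classicalResponse(η) ≲ 4C_s/(C₁β)` («boundary-energetic, centre-calm»). [folklore] -/
theorem coldWallSplit_of_residual {β : ℝ} (hβ : 1 ≤ β) (R : ℕ) (q : Fin 4 × Fin 4) (hq : q.1 < q.2) (x : Fin 4 → ℤ)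
    (η : LGConfig 4 (Matrix.specialUnitaryGroup (Fin 2) ℂ)) {C_s C₁ : ℝ} (hCs : 0 < C_s) (hC₁ : 0 < C₁) (A₂ : ℝ)
    (hres : A₂ < (R : ℝ) ^ 4 / C₁ * (tiltedMin (fundamentalLatticeRep 2) (fun k => x k - (R + 1)) (2 * R + 3) q x 0 η +
        120 * ((2 * R + 3 : ℕ) : ℝ) ^ 4 * ((38 + 12 * Real.log β) / β)) →
      A₂ + carrierCl (fundamentalLatticeRep 2) C_s 1 β R q x η < 4 * (R : ℝ) ^ 4 / C₁ →
      (R : ℝ) ^ 4 / C₁ * |kerE (Matrix.specialUnitaryGroup (Fin 2) ℂ) (fundamentalLatticeRep 2) β (fun k => x k - (R + 1)) (2 * R + 3) η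
            (plane (Matrix.specialUnitaryGroup (Fin 2) ℂ) (fundamentalLatticeRep 2) q x) -
          kerE (Matrix.specialUnitaryGroup (Fin 2) ℂ) (fundamentalLatticeRep 2) β (fun k => x k - (R + 1)) (2 * R + 3) 1
            (plane (Matrix.specialUnitaryGroup (Fin 2) ℂ) (fundamentalLatticeRep 2) q x)| ≤
        A₂ + carrierCl (fundamentalLatticeRep 2) C_s 1 β R q x η) :
    (R : ℝ) ^ 4 / C₁ * |kerE (Matrix.specialUnitaryGroup (Fin 2) ℂ) (fundamentalLatticeRep 2) β (fun k => x k - (R + 1)) (2 * R + 3) η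
          (plane (Matrix.specialUnitaryGroup (Fin 2) ℂ) (fundamentalLatticeRep 2) q x) -
        kerE (Matrix.specialUnitaryGroup (Fin 2) ℂ) (fundamentalLatticeRep 2) β (fun k => x k - (R + 1)) (2 * R + 3) 1
          (plane (Matrix.specialUnitaryGroup (Fin 2) ℂ) (fundamentalLatticeRep 2) q x)| ≤
      A₂ + carrierCl (fundamentalLatticeRep 2) C_s 1 β R q x η := by
  have hcar : 0 ≤ carrierCl (fundamentalLatticeRep 2) C_s 1 β R q x η := carrierCl_nonneg hCs one_pos (by linarith) R q x η
  by_cases h1 : (R : ℝ) ^ 4 / C₁ * (tiltedMin (fundamentalLatticeRep 2) (fun k => x k - (R + 1)) (2 * R + 3) q x 0 η +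
      120 * ((2 * R + 3 : ℕ) : ℝ) ^ 4 * ((38 + 12 * Real.log β) / β)) ≤ A₂
  · -- the energy corner
    have h := coldWallSplit_energyCarrier hβ R q hq x η hC₁
    have hβ0 : 0 < β := by linarith
    have heq : (R : ℝ) ^ 4 / C₁ * tiltedMin (fundamentalLatticeRep 2) (fun k => x k - (R + 1)) (2 * R + 3) q x 0 η +
        120 * (R : ℝ) ^ 4 * ((2 * R + 3 : ℕ) : ℝ) ^ 4 * (38 + 12 * Real.log β) / (C₁ * β) =
        (R : ℝ) ^ 4 / C₁ * (tiltedMin (fundamentalLatticeRep 2) (fun k => x k - (R + 1)) (2 * R + 3) q x 0 η +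
          120 * ((2 * R + 3 : ℕ) : ℝ) ^ 4 * ((38 + 12 * Real.log β) / β)) := by
      field_simp
    rw [heq] at h
    linarith
  · by_cases h2 : 4 * (R : ℝ) ^ 4 / C₁ ≤ A₂ + carrierCl (fundamentalLatticeRep 2) C_s 1 β R q x η
    · exact coldWallSplit_of_large_carrier β R q x η hC₁ C_s A₂ h2
    · exact hres (lt_of_not_ge h1) (lt_of_not_ge h2)

end Summit.QuantumFields.YangMills.Cruxes.UVSeamRec.ClassicalResponse.ColdWall

end
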